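/-
Copyright: b2b-lace packet (explicit-unit carver, gen 18).  DICTIONARY: the recursion layer's orbit NUMBER
`Stage1Cells.V.orbit d v` (D46-SPEC F2) IS the number of points of `ℤ^d` in the symmetry class `v`
(`LatticePointClasses.card_pointClass_eq_div`), for each of the 19 end-point classes of the generated cells.
No numerals beyond the class table already in the tree; no dimension fixed; nothing of the record touched.
-/
import Literature.Probability.FitznerVanDerHofstad2017.Stage1CellsRec
import Literature.Probability.FitznerVanDerHofstad2017.LatticePointClasses
import HarnessLib

/-!
# The recursion layer's orbit sizes are class cardinalities

CITATION HEADER (PLACEMENT v2). This module is part of a certified REPRODUCTION of: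
R. Fitzner, R. van der Hofstad, *Mean-field behavior for nearest-neighbor percolation in d > 10*,
Electron. J. Probab. 22 (2017), no. 43, 1–65 [FvdH17], and *Generalized approach to the non-backtracking
lace expansion*, Probab. Theory Related Fields 169 (2017), 1041–1119 [NoBLE17-I] (arXiv:1506.07977, 1506.07969).
Reproduces: the regrouping of "the sum over all `x ∈ ℤ^d`" of [NoBLE17-I] §5.3.3 by end-point symmetry
classes, as coded in the accompanying notebooks and in the tree's generated recursion layer `Stage1CellsRec`
(`V.orbit d v = 2^k · d.descFactorial k / ∏_j N_j!`, D46-SPEC F2): for every class `v : Stage1Cells.V` and every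
`d ≥ k(v)`, the finite set of lattice points with the absolute-value profile of `v` (`LatticePointClasses.pointClass`)
has exactly `V.orbit d v` elements.  Origin: build `lace`, node N67-W (dictionary line) of `LEMMAS.md`; serves
N67-S2/S3 and N72(b).

## What is here

* `Stage1Cells.V.profile d v : Fin 6 → ℕ` — the profile of class `v` in dimension `d` (`N₀ = d − k` zero
  coordinates, `N_j = (V.mult v)_j` coordinates of absolute value `j = 1..5`);
* `V.sum_profile` (`Σ_j N_j = d` for `k ≤ d`), `V.prod_factorial_profile` (`∏_{j≥1} N_j! = V.symDen v`);
* `Stage1Cells.card_pointClass_profile` — **`#pointClass d 5 (V.profile d v) = V.orbit d v`** for `V.npts v ≤ d`;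
* `Stage1Cells.mem_pointClass_profile` — membership by profile.

## What is NOT here
No walk counts, no cell; no numerals other than the tree's class table.  No cited fact, no named hypothesis,
no `sorry`.

## References
* [NoBLE17-I] R. Fitzner, R. van der Hofstad, PTRF 169 (2017) 1041–1119; arXiv:1506.07969 — §5.3.3.
* [FvdH17] notebooks (Percolation.nb cells 5–24, class notation) as transcribed in `Stage1CellsRec`.
-/

namespace Literature.Probability.FitznerVanDerHofstad2017

namespace Stage1Cells

open Finset

variable {d : ℕ}

/-- The absolute-value PROFILE of the class `v` in dimension `d`: `N₀ = d − k` zero coordinates and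
`N_j = (V.mult v)_j` coordinates of absolute value `j` (`j = 1, …, 5`; `0` beyond the list).
[cite: FitznerVanDerHofstad2017, notebook Percolation.nb cells 5–24 (class notation)] -/
def V.profile (d : ℕ) (v : V) : Fin 6 → ℕ :=
  fun j => if (j : ℕ) = 0 then d - v.npts else v.mult.getD ((j : ℕ) - 1) 0

/-- The zero-level count of the profile is `d − k`. [folklore] -/
@[simp] theorem V.profile_zero (d : ℕ) (v : V) : V.profile d v 0 = d - v.npts := rfl

/-- The positive-level counts of the profile are the multiplicity list (independent of `d`). [folklore] -/
@[simp] theorem V.profile_succ (d : ℕ) (v : V) (j : Fin 5) : V.profile d v j.succ = v.mult.getD j 0 := by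
  simp [V.profile, Fin.val_succ]

/-- `∏_{j=1}^{5} N_j! = V.symDen v`. [folklore] -/
theorem V.prod_factorial_profile (d : ℕ) (v : V) :
    ∏ j : Fin 5, (V.profile d v j.succ).factorial = v.symDen := by
  simp only [V.profile_succ]
  cases v <;> decide

/-- `Σ_{j=1}^{5} N_j = k = V.npts v`. [folklore] -/
theorem V.sum_profile_succ (d : ℕ) (v : V) : ∑ j : Fin 5, V.profile d v j.succ = v.npts := by
  simp only [V.profile_succ]
  cases v <;> decide

/-- `Σ_{j=0}^{5} N_j = d` when `k ≤ d`. [folklore] -/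
theorem V.sum_profile (v : V) (hd : v.npts ≤ d) : ∑ j, V.profile d v j = d := by
  rw [Fin.sum_univ_succ, V.sum_profile_succ, V.profile_zero]
  omega

/-- **The orbit number is the class cardinality**: for every end-point class `v` of the recursion layer and
every `d ≥ k(v)`, `#pointClass d 5 (V.profile d v) = V.orbit d v = 2^k · d!/(d−k)! / ∏_j N_j!`.
[cite: FitznerVanDerHofstad2016NoBLE, §5.3.3 (the sum over all x ∈ ℤ^d, regrouped by symmetry)] -/
theorem card_pointClass_profile (v : V) (hd : v.npts ≤ d) :
    (pointClass d 5 (V.profile d v)).card = V.orbit d v := by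
  rw [card_pointClass_eq_div _ (V.sum_profile v hd), V.prod_factorial_profile, V.profile_zero,
    Nat.sub_sub_self hd]
  rfl

/-- Membership in the class of `v` by profile: `x ∈ pointClass d 5 (V.profile d v)` iff `x` has `d − k`
zero coordinates and `(V.mult v)_j` coordinates of absolute value `j`. [folklore] -/
theorem mem_pointClass_profile (v : V) (hd : v.npts ≤ d) {x : LatticeModels.Site d} :
    x ∈ pointClass d 5 (V.profile d v) ↔ ∀ j : Fin 6, absCount x j = V.profile d v j :=
  mem_pointClass_iff (V.sum_profile v hd)

/-- Sanity instance (the tree's `example`s in `Stage1CellsRec`): at `d = 11` the classes `v1 = {1}` (`±e_μ`),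
`v2 = {2}` (two coordinates `±1`), `v11 = {1,1}` (`±2e_μ ± e_ν`), `v21 = {2,1}` have `22`, `220`, `440`, `3960`
points. [folklore] -/
example : (V.orbit 11 .v1, V.orbit 11 .v2, V.orbit 11 .v11, V.orbit 11 .v21) = (22, 220, 440, 3960) := by decide

end Stage1Cells

end Literature.Probability.FitznerVanDerHofstad2017
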